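import Mathlib.Geometry.Manifold.Instances.Sphere
import Mathlib.Geometry.Manifold.Diffeomorph
import Literature.Topology.FourManifolds.Trisections
import Literature.Topology.FourManifolds.SmoothOrientation
import HarnessLib

/-!
# Named fact: trisected 4-manifolds in the Meier–Schirmer–Zupan range with `χ = 0` are `S¹ × S³`

Named fact (D-0014) requested by the `SmoothPoincare4` crux `WeakReductionReduces`
(stmt-SmoothPoincare4-17908, line `loop_dichotomy`, stub `stub_loopFromGenusThree`): the loop
partner `X` of a homotopy `4`-sphere obtained by surgery on a loop carries a GK-trisection
`(g; k₀, k₁, k₂)` with `χ(X) = 0`, i.e. `k₀ + k₁ + k₂ = g + 2`, and one needs `X ≅ S¹ × S³`.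

## What is printed

* J. Meier, T. Schirmer, A. Zupan, *Classification of trisections and the generalized property R
  conjecture*, Proc. AMS 144 (2016) 4983–4997, arXiv:1507.06561, Def. 1.1: "Let `X` be a closed,
  connected, orientable, smooth four-manifold. A `(g; k₁, k₂, k₃)`–trisection of `X` is …", and
  Thm. 1.2 (arXiv numbering; journal Thm. 1.1): "Suppose that `X` admits a
  `(g; k₁, k₂, k₃)`–trisection `T` with `k₁ ≥ g − 1`, and let `k' = max{k₂, k₃}`.  Then, `X` is
  diffeomorphic either to `#^{k'}(S¹ × S³)` or to the connected sum of `#^{k'}(S¹ × S³)` with one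
  of `ℂP²` or `ℂP²bar`, and `T` is the connected sum of genus one trisections."
* Remark 3.12 there (and Gay–Kirby 2016, Remark 2): "The induced handle decomposition … yields
  `χ(X) = k₁ + k₂ + k₃ − g + 2`" (printed with the sign of `g − Σ kᵢ` flipped; Gay–Kirby:
  `χ(X) = 2 + g − 3k`; checks: `S⁴` `(0;0,0,0)` gives `2`, `ℂP²` `(1;0,0,0)` gives `3`,
  `S¹ × S³` `(1;1,1,1)` gives `0`).  The general identity `χ(X) = 2 + g − Σ kᵢ` over the tree's
  `IsGKTrisection` is PROVED in the tree
  (`Summit.SmoothPoincare4.SmoothPoincare4.Theorems.WeakReductionReduces.LoopDichotomy.relEuler_eq_of_isGKTrisection`,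
  after `gkTrisection_genus_eq_sum_of_homotopyEquiv_sphere_holds`).

## How it is rendered here

Since `χ(#^{k'}(S¹ × S³)) = 2 − 2k'` and `χ(#^{k'}(S¹ × S³) # ±ℂP²) = 3 − 2k'`, the hypothesis
`k₀ + k₁ + k₂ = g + 2` (i.e. `χ(X) = 0`) leaves exactly `k' = 1` and no `±ℂP²` summand:
**`X ≅ S¹ × S³`**.  We vendor this corollary, `msz_chiZero_circleProdSphereThree_gk`, over the
tree's corrected predicate `Literature.Topology.FourManifolds.IsGKTrisection` (sectors with
corners) with an explicit `SmoothOrientation (𝓡 4) X`, exactly in the shape of the tree's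
homotopy-sphere corollary `Literature.Barriers.SmoothPoincare4.msz_homotopySphere_gk`
(`Literature/Barriers/SmoothPoincare4/LowGenusTrisectionsStandard.lean`); `S¹ × S³` is Mathlib's
product manifold `𝕊¹ × 𝕊³` (model `(𝓡 1).prod (𝓡 3)`), as in
`Literature.Topology.FourManifolds.isCircleSurgery_sphereOne_prod_sphereThree_sphereFour`.  The
hypothesis "some `kᵢ ≥ g − 1`" (`∃ i, g ≤ k i + 1`; the sectors may be relabelled) is MSZ's range.
Not in this file: the full list `#^{k'}(S¹ × S³) [# ±ℂP²]` and the statement about `T`.  The full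
list is the tree's named fact `Literature.Topology.FourManifolds.msz_trisection_classification_gk`
(`LargeKTrisectionClassification.lean`: Thm. 1.2 itself, with `k' = min{k₂, k₃}` — the printed
`max` is a misprint, see that file — over `IsCircleProdSum` and `ComplexProjectivePlane`).

Nothing is asserted; users take `(h : msz_chiZero_circleProdSphereThree_gk)`.

## Status (review 2026-08-17): an already-derived node of the MSZ classification

This fact is NOT an independent obligation.  The sibling proof file
`SmallTrisectionsChiZeroProofs.lean` PROVES it from the classification fact, at all universes:
`msz_chiZero_circleProdSphereThree_gk_of_classification :
  msz_trisection_classification_gk.{v} → msz_chiZero_circleProdSphereThree_gk.{u}`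
(every other input — `χ(X) = 2 + g − Σ kᵢ` for GK-trisections, `χ(#ᵏ(S¹ × S³)) = 2 − 2k`,
`χ(#ᵏ(S¹ × S³) # ℂP²) = 3 − 2k`, `#¹(S¹ × S³) ≅ S¹ × S³` — is a theorem of the tree).  So the
discharge of this fact is a one-line application of that reduction to a proof of
`msz_trisection_classification_gk`, once the tree has one, and nothing short of Thm. 1.2 gives it: the
`χ = 0` slice still runs through the Gay–Kirby handle decomposition of a trisection,
Laudenbach–Poénaru, and MSZ Thm. 5.1 (Gabai's Property R / Scharlemann) — middle sector with
`k = g`: no `2`-handle, `X = ♮¹(S¹ × B³) ∪_∂ ♮¹(S¹ × B³)`; with `k = g − 1`: one `2`-handle along a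
knot `L ⊂ #ᵃ(S¹ × S²)` surgering to `#ᵇ(S¹ × S²)`, `a + b = 3`, `(a, b) ∈ {(1, 2), (2, 1)}` by
`H₁`, `L` standard by Thm. 5.1.  The only open obligation behind this name is therefore
`msz_trisection_classification_gk` (whose printed induction on `g` is itself carried out in
`LargeKTrisectionClassificationProofs.lean` modulo reducibility, the splitting of reducible
trisections and the genus-`≤ 1` base).  The `SmoothPoincare4` line `loop_dichotomy` accordingly
pins its MSZ debt to the classification (`stub_mszClassification`) and derives this fact
(`mszChiZero`); the name is kept because accepted files take it as a hypothesis type.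

## References

* [MeierSchirmerZupan2016] Proc. AMS 144 (2016), arXiv:1507.06561: Def. 1.1, Thm. 1.2 (arXiv
  numbering), Remark 3.12.
* [GayKirby2016] Geom. Topol. 20 (2016): Def. 1, Remark 2.
-/

noncomputable section

open scoped Manifold ContDiff

namespace Literature.Topology.FourManifolds

universe u

/-- **Meier–Schirmer–Zupan 2016, Thm. 1.2 (arXiv numbering), in the range `χ(X) = 0` — named
fact.**  Let `X` be a closed, connected, oriented smooth `4`-manifold with a
`(g; k₀, k₁, k₂)`-trisection in the sense of `IsGKTrisection` such that some `kᵢ ≥ g − 1`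
(formally `∃ i, g ≤ k i + 1`) and `k₀ + k₁ + k₂ = g + 2` (i.e. `χ(X) = 2 + g − Σ kᵢ = 0`,
Gay–Kirby Remark 2 / MSZ Remark 3.12).  MSZ: "`X` is diffeomorphic either to `#^{k'}(S¹ × S³)`
or to the connected sum of `#^{k'}(S¹ × S³)` with one of `ℂP²` or `ℂP²bar`"; as
`χ(#^{k'}(S¹ × S³)) = 2 − 2k'` and `χ(#^{k'}(S¹ × S³) # ±ℂP²) = 3 − 2k'`, `χ(X) = 0` forces
`k' = 1` and no `±ℂP²` summand, so **`X` is diffeomorphic to `S¹ × S³`** (Mathlib's product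
manifold `𝕊¹ × 𝕊³`, model `(𝓡 1).prod (𝓡 3)`).  Users take
`(h : msz_chiZero_circleProdSphereThree_gk)`.  **Status: derived** — PROVED from the tree's named
fact `msz_trisection_classification_gk` (Thm. 1.2 itself) by
`msz_chiZero_circleProdSphereThree_gk_of_classification` (`SmallTrisectionsChiZeroProofs.lean`);
the classification is the only open obligation behind this name (module docstring, "Status").
[cite: MeierSchirmerZupan2016, Thm. 1.2 (arXiv numbering) and Remark 3.12] -/
def msz_chiZero_circleProdSphereThree_gk : Prop :=
  ∀ (X : Type u) [TopologicalSpace X] [T2Space X] [SecondCountableTopology X]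
    [ChartedSpace (EuclideanSpace ℝ (Fin 4)) X] [IsManifold (𝓡 4) ∞ X] [CompactSpace X]
    [ConnectedSpace X] (_ : SmoothOrientation (𝓡 4) X) (g : ℕ) (k : Fin 3 → ℕ)
    (S : Fin 3 → Set X), IsGKTrisection X g k S → (∃ i, g ≤ k i + 1) →
      k 0 + k 1 + k 2 = g + 2 →
      Nonempty (X ≃ₘ⟮𝓡 4, (𝓡 1).prod (𝓡 3)⟯
        ((Metric.sphere (0 : EuclideanSpace ℝ (Fin 2)) 1) ×
          (Metric.sphere (0 : EuclideanSpace ℝ (Fin 4)) 1)))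

end Literature.Topology.FourManifolds

end
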